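import Summits.ABC.ABC.Theorems.TwistAmplificationMazurKaneLawRecordDictionary
import Summits.ABC.ABC.Theorems.TwistAmplificationMazurKaneLawRecordLPRA
import Summits.ABC.ABC.Theorems.TwistAmplificationMazurKaneLawRecordLPRE
import Summits.ABC.ABC.Theorems.TwistAmplificationMazurKaneLawRecordLPR53
import Summits.ABC.ABC.Theorems.TwistAmplificationMazurKaneLawRecordEndgame
import Summits.ABC.ABC.Theorems.TwistAmplificationMazurKaneLawRecordTransfer

/-!
# Certified record exponents, pipeline v2 (crux `TwistAmplification.MazurKaneLaw`, stmt-ABC-2757): the PARAMETRIC records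

Line `fibre-toolkit-lp-wall-map`, lead c2. The crux (`#{abc, c ≤ N, rad(abc) ≤ c^s} ≤ C N^{s−1+ε}` for `1 < s < 2`) stays open.
Through the J-generic dictionary theorem `recordInstance_of_lp` the exact linear programme of the enlarged fibre toolkit is certified
here UNIFORMLY IN `s` (the generated LP lemmas `lp_RA`, `lp_RE` carry `s₀` as a real parameter with interval hypotheses; `lp_R53` is
a point):

* `recordAt_RA` : for every `s₀ ∈ [1, 5/3]`, `RecordAt s₀ ((23 s₀ + 1)/40)`; in the crux's literal shape
  (`mazurKane_count_le_rpow_RA`): for `1 ≤ s < 5/3` and `ε > 0`, `#{abc triples, c ≤ N, rad(abc) ≤ c^s} ≤ C · N^{(23s+1)/40 + ε}` —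
  the 2026 exponent `(23λ+3)/40` of Bernert–Browning–Lichtman–Teräväinen (v2, Thm 1.2) lowered by `1/20` uniformly on `[1, 5/3)`
  (the kit's exact value is lower still: `.586 / .641 / .692 / .752 / .806 / .866 / .929` at `s = 1, 1.1, …, 1.6`, `J = 5`).
* `recordAt_53` : `RecordAt (5/3) (24/25)` (kit value `.9573` on `[1.65, 5/3]`).
* `recordAt_RE` : for every `s₀ ∈ [7/4, 16/9]`, `RecordAt s₀ (4 s₀/5 − 2107/5000)`; literally (`mazurKane_count_le_rpow_RE`): for
  `7/4 ≤ s < 16/9`, `#{…} ≤ C · N^{4s/5 − 2107/5000 + ε}`, an exponent `< 1` — a POWER SAVING BELOW KANE'S `N^{1+ε}` — for every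
  `s < 7107/4000 = 1.77675`. The kit's exact LP value is `1 − (4/5)(16/9 − s) + o(1)` near `16/9` and equals `1` from `s = 16/9` on
  (maximiser at `16/9`: two terms `u x² w³` with exponents `(2/9, 2/9, 1/9)`, one term `u x²` with `(1/3, 1/3)` — the conic family
  `R(δ,2)`), so `16/9` is the end of what this toolkit certifies; the last `1/1000` below it is the slack cap of `RecordInstance`.

Together with `recordAt_74` (`49/50` below `7/4`, lead c1) the certified exponent is `< 1` on all of `(1, 1.77675)` and below
`min(1, (23s+3)/40)` on all of `[1, 16/9)`.
-/

noncomputable section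

-- `Summit.<Summit>.<Problem>`: the duplicate `ABC.ABC` is deliberate (single-conjunct summit).
set_option linter.dupNamespace false

namespace Summit.ABC.ABC.Theorems.MazurKaneLaw

open Summit.ABC.ABC.Theorems.MazurKaneLaw.Toolkit

/-- Monotonicity of a record bound in the exponent: a bound `C · N^{e₁}` with `e₁ ≤ e₂` gives `max C 0 · N^{e₂}` for `N ≥ 2`. -/
theorem record_bound_mono {C e₁ e₂ : ℝ} {N : ℕ} (hN : 2 ≤ N) (he : e₁ ≤ e₂) {x : ℝ} (hx : x ≤ C * (N : ℝ) ^ e₁) :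
    x ≤ max C 0 * (N : ℝ) ^ e₂ := by
  have hN1 : (1 : ℝ) ≤ N := by exact_mod_cast (by omega : 1 ≤ N)
  have h1 : C * (N : ℝ) ^ e₁ ≤ max C 0 * (N : ℝ) ^ e₁ :=
    mul_le_mul_of_nonneg_right (le_max_left _ _) (Real.rpow_nonneg (by linarith) _)
  have h2 : max C 0 * (N : ℝ) ^ e₁ ≤ max C 0 * (N : ℝ) ^ e₂ :=
    mul_le_mul_of_nonneg_left (Real.rpow_le_rpow_of_exponent_le hN1 he) (le_max_right _ _)
  linarith

/-! ### `RA`: `s₀ ∈ [1, 5/3]`, exponent `(23 s₀ + 1)/40` -/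

/-- `lp_RA` with the conclusion in the dictionary's shape `D ≤ Vc + σ` (the generated lemma prints `σ` first). -/
theorem lp_RA_std : ∀ s₀ : ℝ, 1 ≤ s₀ → s₀ ≤ 5 / 3 → ∀ (a b c : Fin 5 → ℝ) (A B C D da db dc σ : ℝ), (∀ k, 0 ≤ a k) → (∀ k, 0 ≤ b k) → (∀ k, 0 ≤ c k) → ∑ k, a k ≤ A → ∑ k, b k ≤ B → ∑ k, c k ≤ C → ((5 : ℝ) + 1) * A - ∑ k : Fin 5, ((5 : ℝ) - ((k : ℕ) : ℝ)) * a k ≤ 1 - da → 0 ≤ da → da ≤ 1 → ((5 : ℝ) + 1) * B - ∑ k : Fin 5, ((5 : ℝ) - ((k : ℕ) : ℝ)) * b k ≤ 1 - db → 0 ≤ db → db ≤ 1 → ((5 : ℝ) + 1) * C - ∑ k : Fin 5, ((5 : ℝ) - ((k : ℕ) : ℝ)) * c k ≤ 1 - dc → 0 ≤ dc → dc ≤ σ → 0 ≤ σ → σ ≤ 1 / 1000 → A + B + C ≤ s₀ + σ → D ≤ A + B + σ → D ≤ A + C + σ → D ≤ B + C + σ → (∀ k : Fin 5, 1 ≤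 (k : ℕ) → D ≤ A + B + C - (a k + b k + c k) + σ ∨ D ≤ A + B + C - 1 + ((((k : ℕ) : ℝ) - 1) * (a k + b k + c k) + (da + db + dc)) / 3 + σ) → (∀ (SU SV SW : Finset (Fin 5)) (eU eV eW : ℕ), 2 ≤ eU → 2 ≤ eV → 2 ≤ eW → (∀ k ∈ SU, eU ∣ (k : ℕ) + 1) → (∀ k ∈ SV, eV ∣ (k : ℕ) + 1) → (∀ k ∈ SW, eW ∣ (k : ℕ) + 1) → ∑ k ∈ SU, a k + ∑ k ∈ SV, b k + ∑ k ∈ SW, c k ≤ 4 * (A + B + C) - 6 * D + σ) → (∀ (I J' K : Finset (Fin 5)), ∑ k ∈ I, a k + ∑ k ∈ J', b k + ∑ k ∈ K, c k ≤ A + B + C - D + σ ∨ 1 - (∑ k ∈ I, ((k : ℕ) : ℝ) * a k + ∑ k ∈ J', ((k : ℕ) : ℝ) * b k + ∑ k ∈ K, ((k : ℕ) : ℝ) * c k) ≤ A + B + C - D + σ) → (∀ (H : Finset (Fin 5)) (k : Fin 5), 1 ≤ (k : ℕ) → D ≤ A + B + C - (1 - da) + ∑ j ∈ H, ((j : ℕ)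 : ℝ) * a j + σ ∨ D ≤ A + B + C - (∑ j ∈ H, a j + b k + c k) + σ) → (∀ (H : Finset (Fin 5)) (k : Fin 5), 1 ≤ (k : ℕ) → D ≤ A + B + C - (1 - db) + ∑ j ∈ H, ((j : ℕ) : ℝ) * b j + σ ∨ D ≤ A + B + C - (∑ j ∈ H, b j + a k + c k) + σ) → (∀ (H : Finset (Fin 5)) (k : Fin 5), 1 ≤ (k : ℕ) → D ≤ A + B + C - (1 - dc) + ∑ j ∈ H, ((j : ℕ) : ℝ) * c j + σ ∨ D ≤ A + B + C - (∑ j ∈ H, c j + a k + b k) + σ) → D ≤ (23 / 40 : ℝ) * s₀ + (1 / 40 : ℝ) + σ := by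
  intro s₀ hslo hshi a b c A B C D da db dc σ ha hb hc hTa0 hTb0 hTc0 hWa0 hda0 hda1 hWb0 hdb0 hdb1 hWc0 hdc0 hdcs hs0 hsm hL hT_ab hT_ac hT_bc hDt hF hG hQa hQb hQc
  have h := lp_RA s₀ hslo hshi a b c A B C D da db dc σ ha hb hc hTa0 hTb0 hTc0 hWa0 hda0 hda1 hWb0 hdb0 hdb1 hWc0 hdc0 hdcs hs0 hsm hL hT_ab hT_ac hT_bc hDt hF hG hQa hQb hQc
  linarith only [h]

/-- **Parametric record instance `RA`** (registered sub-goal `recordInstance_RA`): for every `s₀ ∈ [1, 5/3]`,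
`RecordInstance 5 s₀ ((23/40) s₀ + 1/40)`, from the generated parametric LP lemma `lp_RA` through `recordInstance_of_lp`. -/
theorem recordInstance_RA : ∀ s₀ : ℝ, 1 ≤ s₀ → s₀ ≤ 5 / 3 → Summit.ABC.ABC.Theorems.MazurKaneLaw.Toolkit.RecordInstance 5 s₀ ((23 / 40 : ℝ) * s₀ + (1 / 40 : ℝ)) :=
  fun s₀ h1 h2 => recordInstance_of_lp 5 s₀ ((23 / 40 : ℝ) * s₀ + (1 / 40 : ℝ)) (by norm_num) (lp_RA_std s₀ h1 h2)

/-- **Parametric certified record `RA`** (registered sub-goal `recordAt_RA` of crux stmt-ABC-2757): for every `s₀ ∈ [1, 5/3]`,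
every `s < s₀` and `ε > 0`, `#{abc triples, c ≤ N, rad(abc) ≤ c^s} ≤ C · N^{(23 s₀ + 1)/40 + ε}` for `N ≥ 2`. -/
theorem recordAt_RA : ∀ s₀ : ℝ, 1 ≤ s₀ → s₀ ≤ 5 / 3 → Summit.ABC.ABC.Theorems.MazurKaneLaw.Toolkit.RecordAt s₀ ((23 / 40 : ℝ) * s₀ + (1 / 40 : ℝ)) :=
  fun s₀ h1 h2 => recordAt_of_shapeBound 5 s₀ ((23 / 40 : ℝ) * s₀ + (1 / 40 : ℝ)) (by norm_num) (by norm_num) (by linarith)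
    (by linarith) (shapeCount_le_of_recordInstance 5 s₀ ((23 / 40 : ℝ) * s₀ + (1 / 40 : ℝ)) (by norm_num) (by linarith)
      (recordInstance_RA s₀ h1 h2))

/-- **`RA` in the crux's literal shape**: for `1 ≤ s < 5/3` and `ε > 0` there is `C` with
`#{abc triples (a,b,c) : c ≤ N, rad(abc) ≤ c^s} ≤ C · N^{(23 s + 1)/40 + ε}` for all `N ≥ 2` (BBLT's `(23s+3)/40` minus `1/20`).
Take `s₀ = min (5/3) (s + ε)` in `recordAt_RA` with `ε′ = 17ε/40`. -/
theorem mazurKane_count_le_rpow_RA (s : ℝ) (hs1 : 1 ≤ s) (hs2 : s < 5 / 3) (ε : ℝ) (hε : 0 < ε) :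
    ∃ C : ℝ, ∀ N : ℕ, 2 ≤ N →
      (Set.ncard {t : ℕ × ℕ × ℕ | Literature.NumberTheory.DiophantineGeometry.IsABCTriple t.1 t.2.1 t.2.2 ∧ t.2.2 ≤ N ∧
        ((Literature.NumberTheory.DiophantineGeometry.rad t.1 t.2.1 t.2.2 : ℕ) : ℝ) ≤ (t.2.2 : ℝ) ^ s} : ℝ) ≤
        C * (N : ℝ) ^ ((23 * s + 1) / 40 + ε) := by
  have hm1 : min (5 / 3) (s + ε) ≤ 5 / 3 := min_le_left _ _
  have hm2 : min (5 / 3) (s + ε) ≤ s + ε := min_le_right _ _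
  have hm3 : s < min (5 / 3) (s + ε) := lt_min hs2 (by linarith)
  obtain ⟨C, hC⟩ := recordAt_RA (min (5 / 3) (s + ε)) (by linarith) hm1 s hm3 (17 * ε / 40) (by positivity)
  exact ⟨max C 0, fun N hN => record_bound_mono hN (by linarith) (hC N hN)⟩

/-! ### `R53`: the point `s₀ = 5/3`, exponent `24/25` -/

/-- **Record instance `R53`** (registered sub-goal `recordInstance_R53`): `RecordInstance 5 (5/3) (24/25)`. -/
theorem recordInstance_R53 : Summit.ABC.ABC.Theorems.MazurKaneLaw.Toolkit.RecordInstance 5 (5 / 3) (24 / 25) :=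
  recordInstance_of_lp 5 (5 / 3) (24 / 25) (by norm_num) lp_R53

/-- **Certified record at `s₀ = 5/3` with exponent `24/25`** (registered sub-goal `recordAt_53`): for every `s < 5/3` and `ε > 0`,
`#{abc triples, c ≤ N, rad(abc) ≤ c^s} ≤ C · N^{24/25 + ε}` for `N ≥ 2`. -/
theorem recordAt_53 : Summit.ABC.ABC.Theorems.MazurKaneLaw.Toolkit.RecordAt (5 / 3) (24 / 25) :=
  recordAt_of_shapeBound 5 (5 / 3) (24 / 25) (by norm_num) (by norm_num) (by norm_num) (by norm_num)
    (shapeCount_le_of_recordInstance 5 (5 / 3) (24 / 25) (by norm_num) (by norm_num) recordInstance_R53)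

/-! ### `RE`: `s₀ ∈ [7/4, 16/9]`, exponent `4 s₀/5 − 2107/5000` (below `1` for `s₀ < 7107/4000`) -/

/-- `lp_RE` with the conclusion in the dictionary's shape `D ≤ Vc + σ` (the generated lemma prints `σ` first). -/
theorem lp_RE_std : ∀ s₀ : ℝ, 7 / 4 ≤ s₀ → s₀ ≤ 16 / 9 → ∀ (a b c : Fin 5 → ℝ) (A B C D da db dc σ : ℝ), (∀ k, 0 ≤ a k) → (∀ k, 0 ≤ b k) → (∀ k, 0 ≤ c k) → ∑ k, a k ≤ A → ∑ k, b k ≤ B → ∑ k, c k ≤ C → ((5 : ℝ) + 1) * A - ∑ k : Fin 5, ((5 : ℝ) - ((k : ℕ) : ℝ)) * a k ≤ 1 - da → 0 ≤ da → da ≤ 1 → ((5 : ℝ) + 1) * B - ∑ k : Fin 5, ((5 : ℝ) - ((k : ℕ) : ℝ)) * b k ≤ 1 - db → 0 ≤ db → db ≤ 1 → ((5 : ℝ) + 1) * C - ∑ k : Fin 5, ((5 : ℝ) - ((k : ℕ) : ℝ)) * c k ≤ 1 - dc → 0 ≤ dc → dc ≤ σ → 0 ≤ σ → σ ≤ 1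 / 1000 → A + B + C ≤ s₀ + σ → D ≤ A + B + σ → D ≤ A + C + σ → D ≤ B + C + σ → (∀ k : Fin 5, 1 ≤ (k : ℕ) → D ≤ A + B + C - (a k + b k + c k) + σ ∨ D ≤ A + B + C - 1 + ((((k : ℕ) : ℝ) - 1) * (a k + b k + c k) + (da + db + dc)) / 3 + σ) → (∀ (SU SV SW : Finset (Fin 5)) (eU eV eW : ℕ), 2 ≤ eU → 2 ≤ eV → 2 ≤ eW → (∀ k ∈ SU, eU ∣ (k : ℕ) + 1) → (∀ k ∈ SV, eV ∣ (k : ℕ) + 1) → (∀ k ∈ SW, eW ∣ (k : ℕ) + 1) → ∑ k ∈ SU, a k + ∑ k ∈ SV, b k + ∑ k ∈ SW, c k ≤ 4 * (A + B + C) - 6 * D + σ) → (∀ (I J' K : Finset (Fin 5)), ∑ k ∈ I, a k + ∑ k ∈ J', b k + ∑ k ∈ K, c k ≤ A + B + C - D + σ ∨ 1 - (∑ k ∈ I, ((k : ℕ) : ℝ) * a k + ∑ k ∈ J', ((k : ℕ) : ℝ) * b k + ∑ k ∈ K, ((k : ℕ) : ℝ) * c k) ≤ A + B + C - D + σ) →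 (∀ (H : Finset (Fin 5)) (k : Fin 5), 1 ≤ (k : ℕ) → D ≤ A + B + C - (1 - da) + ∑ j ∈ H, ((j : ℕ) : ℝ) * a j + σ ∨ D ≤ A + B + C - (∑ j ∈ H, a j + b k + c k) + σ) → (∀ (H : Finset (Fin 5)) (k : Fin 5), 1 ≤ (k : ℕ) → D ≤ A + B + C - (1 - db) + ∑ j ∈ H, ((j : ℕ) : ℝ) * b j + σ ∨ D ≤ A + B + C - (∑ j ∈ H, b j + a k + c k) + σ) → (∀ (H : Finset (Fin 5)) (k : Fin 5), 1 ≤ (k : ℕ) → D ≤ A + B + C - (1 - dc) + ∑ j ∈ H, ((j : ℕ) : ℝ) * c j + σ ∨ D ≤ A + B + C - (∑ j ∈ H, c j + a k + b k) + σ) → D ≤ (4 / 5 : ℝ) * s₀ - (2107 / 5000 : ℝ) + σ := by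
  intro s₀ hslo hshi a b c A B C D da db dc σ ha hb hc hTa0 hTb0 hTc0 hWa0 hda0 hda1 hWb0 hdb0 hdb1 hWc0 hdc0 hdcs hs0 hsm hL hT_ab hT_ac hT_bc hDt hF hG hQa hQb hQc
  have h := lp_RE s₀ hslo hshi a b c A B C D da db dc σ ha hb hc hTa0 hTb0 hTc0 hWa0 hda0 hda1 hWb0 hdb0 hdb1 hWc0 hdc0 hdcs hs0 hsm hL hT_ab hT_ac hT_bc hDt hF hG hQa hQb hQc
  linarith only [h]


/-- **Parametric record instance `RE`** (registered sub-goal `recordInstance_RE`): for every `s₀ ∈ [7/4, 16/9]`,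
`RecordInstance 5 s₀ ((4/5) s₀ − 2107/5000)`, from the generated parametric LP lemma `lp_RE`. -/
theorem recordInstance_RE : ∀ s₀ : ℝ, 7 / 4 ≤ s₀ → s₀ ≤ 16 / 9 → Summit.ABC.ABC.Theorems.MazurKaneLaw.Toolkit.RecordInstance 5 s₀ ((4 / 5 : ℝ) * s₀ - (2107 / 5000 : ℝ)) :=
  fun s₀ h1 h2 => recordInstance_of_lp 5 s₀ ((4 / 5 : ℝ) * s₀ - (2107 / 5000 : ℝ)) (by norm_num) (lp_RE_std s₀ h1 h2)

/-- **Parametric certified record `RE`** (registered sub-goal `recordAt_RE` of crux stmt-ABC-2757): for every `s₀ ∈ [7/4, 16/9]`,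
every `s < s₀` and `ε > 0`, `#{abc triples, c ≤ N, rad(abc) ≤ c^s} ≤ C · N^{4 s₀/5 − 2107/5000 + ε}` for `N ≥ 2`; the exponent is
`< 1` exactly when `s₀ < 7107/4000 = 1.77675` — the first power saving below Kane's `N^{1+ε}` on `[7/4, 1.77675)`. -/
theorem recordAt_RE : ∀ s₀ : ℝ, 7 / 4 ≤ s₀ → s₀ ≤ 16 / 9 → Summit.ABC.ABC.Theorems.MazurKaneLaw.Toolkit.RecordAt s₀ ((4 / 5 : ℝ) * s₀ - (2107 / 5000 : ℝ)) :=
  fun s₀ h1 h2 => recordAt_of_shapeBound 5 s₀ ((4 / 5 : ℝ) * s₀ - (2107 / 5000 : ℝ)) (by norm_num) (by norm_num) (by linarith)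
    (by linarith) (shapeCount_le_of_recordInstance 5 s₀ ((4 / 5 : ℝ) * s₀ - (2107 / 5000 : ℝ)) (by norm_num) (by linarith)
      (recordInstance_RE s₀ h1 h2))

/-- **`RE` in the crux's literal shape**: for `7/4 ≤ s < 16/9` and `ε > 0` there is `C` with
`#{abc triples (a,b,c) : c ≤ N, rad(abc) ≤ c^s} ≤ C · N^{4s/5 − 2107/5000 + ε}` for all `N ≥ 2`; for `s < 7107/4000` and small `ε`
the exponent is `< 1 = ` Kane's. Take `s₀ = min (16/9) (s + ε)` in `recordAt_RE` with `ε′ = ε/5`. -/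
theorem mazurKane_count_le_rpow_RE (s : ℝ) (hs1 : 7 / 4 ≤ s) (hs2 : s < 16 / 9) (ε : ℝ) (hε : 0 < ε) :
    ∃ C : ℝ, ∀ N : ℕ, 2 ≤ N →
      (Set.ncard {t : ℕ × ℕ × ℕ | Literature.NumberTheory.DiophantineGeometry.IsABCTriple t.1 t.2.1 t.2.2 ∧ t.2.2 ≤ N ∧
        ((Literature.NumberTheory.DiophantineGeometry.rad t.1 t.2.1 t.2.2 : ℕ) : ℝ) ≤ (t.2.2 : ℝ) ^ s} : ℝ) ≤
        C * (N : ℝ) ^ (4 * s / 5 - 2107 / 5000 + ε) := by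
  have hm1 : min (16 / 9) (s + ε) ≤ 16 / 9 := min_le_left _ _
  have hm2 : min (16 / 9) (s + ε) ≤ s + ε := min_le_right _ _
  have hm3 : s < min (16 / 9) (s + ε) := lt_min hs2 (by linarith)
  obtain ⟨C, hC⟩ := recordAt_RE (min (16 / 9) (s + ε)) (by linarith) hm1 s hm3 (ε / 5) (by positivity)
  exact ⟨max C 0, fun N hN => record_bound_mono hN (by linarith) (hC N hN)⟩

/-- The sub-Kane window in one line: for every `s < 7107/4000` (`= 1.77675`) with `7/4 ≤ s` there are `θ < 1` and `C` with
`#{abc triples, c ≤ N, rad(abc) ≤ c^s} ≤ C · N^θ` for all `N ≥ 2`. -/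
theorem mazurKane_count_subKane (s : ℝ) (hs1 : 7 / 4 ≤ s) (hs2 : s < 7107 / 4000) :
    ∃ θ : ℝ, θ < 1 ∧ ∃ C : ℝ, ∀ N : ℕ, 2 ≤ N →
      (Set.ncard {t : ℕ × ℕ × ℕ | Literature.NumberTheory.DiophantineGeometry.IsABCTriple t.1 t.2.1 t.2.2 ∧ t.2.2 ≤ N ∧
        ((Literature.NumberTheory.DiophantineGeometry.rad t.1 t.2.1 t.2.2 : ℕ) : ℝ) ≤ (t.2.2 : ℝ) ^ s} : ℝ) ≤ C * (N : ℝ) ^ θ := by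
  obtain ⟨C, hC⟩ := mazurKane_count_le_rpow_RE s hs1 (by linarith) ((1 - (4 * s / 5 - 2107 / 5000)) / 2) (by linarith)
  exact ⟨4 * s / 5 - 2107 / 5000 + (1 - (4 * s / 5 - 2107 / 5000)) / 2, by linarith, C, hC⟩

end Summit.ABC.ABC.Theorems.MazurKaneLaw

end
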